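import Summits.Ventures.HodgeRepro2.T5RecordSatakeToy
import Summits.Ventures.HodgeRepro2.T5InertPrimeToy
import Summits.Ventures.HodgeRepro2.T5CMCensusToy

/-!
# The record's spherical Hecke algebra at a CONCRETE inert place: `ℚ(i)` at `3`, `H₀ = diag(1, 1, −1)`

Tier-5 support N3 / §G-N4.2 (seat p3, gen 77). Files 233 / 236 say: at every place `v` of `K⁺` that stays prime
in the CM field `K` (`v 𝓞_K = w`) and is good for the Gram matrix, the record's spherical Hecke algebra
`H(U(1 ⊗ H), K_v)` is commutative and `≃ k[X]`. This file reads that at ONE concrete place of ONE concrete CM field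
(README §10.5 (ii)(c)/(d)): `L = ℚ(ζ₄) = ℚ(i)` (any fourth cyclotomic extension of `ℚ`, seat p8's
`T5CMCensusToy.isCMField_four`), the prime `3`, which stays prime in `ℚ(i)` (seat p8's `T5InertPrimeToy`:
`wThree L` = the place `(3)` of `L`, `(3) 𝓞_L = (3)` by Kummer–Dedekind), and the Gram matrix `H₀ = diag(1, 1, −1)`
of file 237, good at every finite place.

The place of `L⁺ = maximalRealSubfield L` under `(3)` is CONSTRUCTED as the contraction of `wThree L`
(`vThreePlus`), so that `wThree L` lies over it by definition and `v 𝓞_L = w` follows from `3 ∈ v`: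

* `vThreePlus`, `vThreePlus_asIdeal`, `three_mem_vThreePlus`, `liesOver_vThreePlus` — the place `(3)` of `L⁺`;
* **`map_vThreePlus`** — `(3) 𝓞_L = (3)`, the hypothesis `hmap` of files 233 / 236, at the concrete place;
* **`heckeAlgebra_mul_comm_record_three`** — `H(U(1 ⊗ H₀), K_{(3)})` is commutative, for every family `l` of
  generators of `𝓞_L` over `𝓞_{L⁺}` and every field `k`;
* **`nonempty_algEquiv_polynomial_record_three`** — it is `k[X]` (the Satake chain, rows 1–14 of
  T5-SATAKE-KERNEL-p3.md, read on the record's own pair at the concrete inert place `(3)` of `ℚ(i)`);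
* `exists_generators_and_nonempty_algEquiv_polynomial_record_three` — with the generators supplied by file 235.

§8(d): uses an L-value-free non-vanishing device: NO.
-/

open Matrix NumberField NumberField.IsCMField IsDedekindDomain IsDedekindDomain.HeightOneSpectrum Module
open scoped TensorProduct Pointwise
open Summit.Ventures.HodgeRepro2.T5HeckePermutationModule Summit.Ventures.HodgeRepro2.T5RecordHyperspecial
  Summit.Ventures.HodgeRepro2.T5GlobalLatticeAlmostAll Summit.Ventures.HodgeRepro2.T5FinitePlaceSplitClassification
  Summit.Ventures.HodgeRepro2.T5RecordSatakeIntrinsic Summit.Ventures.HodgeRepro2.T5CMFieldSquareDatum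
  Summit.Ventures.HodgeRepro2.T5RecordSatakeToy Summit.Ventures.HodgeRepro2.T5InertPrimeToy
  Summit.Ventures.HodgeRepro2.T5CMCensusToy

namespace Summit.Ventures.HodgeRepro2.T5RecordSatakeInertToy

section Place

variable (L : Type*) [Field L] [CharZero L] [IsCyclotomicExtension {2 ^ 2} ℚ L]

/-- `L` is a number field (Mathlib's `IsCyclotomicExtension.numberField`), as a theorem to `haveI` inside statements. -/
theorem numberField : NumberField L := IsCyclotomicExtension.numberField {2 ^ 2} ℚ L

omit [IsCyclotomicExtension {2 ^ 2} ℚ L] in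
/-- `3 ≠ 0` in `𝓞_L` (through the embedding into `L`, of characteristic `0`). -/
theorem three_ne_zero' : (3 : 𝓞 L) ≠ 0 := fun h => by
  have h' := congrArg (algebraMap (𝓞 L) L) h
  rw [map_ofNat, map_zero] at h'
  exact three_ne_zero h'

/-- `3` lies in the place `(3)` of `L` (seat p8's `wThree L`). -/
theorem three_mem_wThree : (3 : 𝓞 L) ∈ (wThree L).asIdeal := by
  rw [wThree_asIdeal]
  exact Ideal.mem_span_singleton_self 3

/-- **The place `(3)` of `L⁺ = maximalRealSubfield L`**, constructed as the contraction of the place `(3)` of `L`. -/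
noncomputable def vThreePlus : HeightOneSpectrum (𝓞 (maximalRealSubfield L)) where
  asIdeal := Ideal.comap (algebraMap (𝓞 (maximalRealSubfield L)) (𝓞 L)) (wThree L).asIdeal
  isPrime := Ideal.IsPrime.comap _
  ne_bot := Ideal.comap_ne_bot_of_integral_mem (three_ne_zero' L) (three_mem_wThree L)
    (Algebra.IsIntegral.isIntegral _)

/-- The ideal of `vThreePlus` is the contraction of `(3)`. -/
theorem vThreePlus_asIdeal :
    (vThreePlus L).asIdeal = Ideal.comap (algebraMap (𝓞 (maximalRealSubfield L)) (𝓞 L)) (wThree L).asIdeal :=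
  rfl

/-- `3 ∈ vThreePlus`. -/
theorem three_mem_vThreePlus : (3 : 𝓞 (maximalRealSubfield L)) ∈ (vThreePlus L).asIdeal := by
  rw [vThreePlus_asIdeal, Ideal.mem_comap, map_ofNat]
  exact three_mem_wThree L

/-- `wThree L` lies over `vThreePlus L`. -/
instance liesOver_vThreePlus : (wThree L).asIdeal.LiesOver (vThreePlus L).asIdeal := ⟨rfl⟩

/-- **`3` stays prime in `ℚ(i)`, from `L⁺`**: `(3) 𝓞_L = (3)` — the hypothesis `hmap` of files 233 / 236 at the
concrete place (`map (comap w) ≤ w` always; `(3) = span {3} ≤ map (comap w)` because `3 ∈ comap w`). -/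
theorem map_vThreePlus :
    Ideal.map (algebraMap (𝓞 (maximalRealSubfield L)) (𝓞 L)) (vThreePlus L).asIdeal = (wThree L).asIdeal := by
  refine le_antisymm Ideal.map_comap_le ?_
  rw [wThree_asIdeal, Ideal.span_le, Set.singleton_subset_iff]
  have h := Ideal.mem_map_of_mem (algebraMap (𝓞 (maximalRealSubfield L)) (𝓞 L)) (three_mem_vThreePlus L)
  rwa [map_ofNat] at h

end Place

section Record

variable (L : Type*) [Field L] [CharZero L] [IsCyclotomicExtension {2 ^ 2} ℚ L]

/-- **THE RECORD'S SPHERICAL HECKE ALGEBRA AT THE INERT PLACE `(3)` OF `ℚ(i)` IS COMMUTATIVE** (file 236's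
`heckeAlgebra_mul_comm_record_of_staysPrime` with `hmap := map_vThreePlus`, `H := H₀`). -/
theorem heckeAlgebra_mul_comm_record_three (k : Type*) [Field k] {r : ℕ} (l : Fin r → 𝓞 L)
    (hl : Submodule.span (𝓞 (maximalRealSubfield L)) (Set.range l) = ⊤)
    (T S : (haveI := numberField L; haveI := isCMField_four L; letI := tensorStarRing L (vThreePlus L);
      ↥(heckeAlgebra k (recordHyperspecial L (vThreePlus L) l (gramToy L))))) :
    T * S = S * T :=
  haveI := numberField L
  haveI := isCMField_four L
  heckeAlgebra_mul_comm_record_of_staysPrime L (vThreePlus L) (wThree L) l k hl (map_vThreePlus L)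
    gramToy_isHermitian isUnit_det_gramToy (notMem_badSet_gramToy _) T S

/-- **THE RECORD'S SPHERICAL HECKE ALGEBRA AT THE INERT PLACE `(3)` OF `ℚ(i)` IS `k[X]`** — the Satake chain
(rows 1–14 of T5-SATAKE-KERNEL-p3.md) read on the record's own pair at a concrete inert place (file 236's
`nonempty_algEquiv_polynomial_record_of_staysPrime`). -/
theorem nonempty_algEquiv_polynomial_record_three (k : Type*) [Field k] {r : ℕ} (l : Fin r → 𝓞 L)
    (hl : Submodule.span (𝓞 (maximalRealSubfield L)) (Set.range l) = ⊤) :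
    haveI := numberField L; haveI := isCMField_four L
    Nonempty (Polynomial k ≃ₐ[k]
      (letI := tensorStarRing L (vThreePlus L);
        ↥(heckeAlgebra k (recordHyperspecial L (vThreePlus L) l (gramToy L))))) :=
  haveI := numberField L
  haveI := isCMField_four L
  nonempty_algEquiv_polynomial_record_of_staysPrime L (vThreePlus L) (wThree L) l k hl (map_vThreePlus L)
    gramToy_isHermitian isUnit_det_gramToy (notMem_badSet_gramToy _)

/-- **With the generators supplied** (file 235's `exists_fin_span_eq_top`): there are generators `l` of `𝓞_L` over
`𝓞_{L⁺}` with `H(U(1 ⊗ H₀), K_{(3)}) ≃ k[X]` — the whole hypothesis set of the inert-place statement inhabited on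
`ℚ(i)` at `3`. -/
theorem exists_generators_and_nonempty_algEquiv_polynomial_record_three (k : Type*) [Field k] :
    haveI := numberField L; haveI := isCMField_four L
    ∃ (r : ℕ) (l : Fin r → 𝓞 L), Submodule.span (𝓞 (maximalRealSubfield L)) (Set.range l) = ⊤ ∧
      Nonempty (Polynomial k ≃ₐ[k]
        (letI := tensorStarRing L (vThreePlus L);
          ↥(heckeAlgebra k (recordHyperspecial L (vThreePlus L) l (gramToy L))))) :=
  haveI := numberField L
  haveI := isCMField_four L
  (exists_fin_span_eq_top L).elim fun r h => h.elim fun l hl =>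
    ⟨r, l, hl, nonempty_algEquiv_polynomial_record_three L k l hl⟩

end Record

end Summit.Ventures.HodgeRepro2.T5RecordSatakeInertToy
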